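import Summits.ResolutionOfSingularities.ResolutionOfSingularities.Theorems.FrobeniusLadderFInjectiveMacaulayficationProp44TauOneChainBlocks
import Summits.ResolutionOfSingularities.ResolutionOfSingularities.Theorems.FrobeniusLadderFInjectiveMacaulayficationProp44CurveStepSucc
import Summits.ResolutionOfSingularities.ResolutionOfSingularities.Theorems.FrobeniusLadderFInjectiveMacaulayficationProp44LineCentre
import Literature.AlgebraicGeometry.Resolution.PointStepTrichotomy
import Literature.AlgebraicGeometry.Resolution.NearChainTermination
import Literature.AlgebraicGeometry.Resolution.IsolatedOrderPoint
import HarnessLib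

/-!
# Cossart–Piltant 2008, Prop. 4.4 — the T1 line: GLUE between the scheme chain and the ring contract

OURS (res-inputs-p-8b g2; the PROVED lemmas of the T1 skeleton v1.1 73f54af9a28e2ef0). For the chain of `τ = 1` near points of
`stub_T1_false_of_nearChain_tau_one` (SIGNATURES v4 l.340) read in the local rings `R_n = 𝒪_{X_n,x_n}` with the maps `stalkMapCongr`
(`NearChainTermination` §Chain), this file transports the landed scheme-side bricks to the shape of res-inputs-p-7b's ring CONTRACT v2
`false_of_unitChain_tau_one_rational` (d8a51aeaad16ab3e): σ (p626364) at a point `q = x′`; the bridge forms → `IsAdapted` (p627247); the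
prime ↔ generisation dictionary `ord_ζ J ≥ μ ⇐ J_x 𝒪_𝔮 ⊆ 𝔮^μ` (Stacks 01J7); the weak transform's stalk as the colon by `(φ u)^μ`; κ″ (p626243)
at `q = x′`; «non-rational ⇒ `k(x) → k(x′)` not onto»; «`𝔪` of embedding dimension `3` is not 2-generated»; and the LINE CENTRE in chain form
(p627545 ∘ p623553: after a point step in the `u`-chart the next curve centre is `(y′, φ u)` at `x_{n+1}` for every adapted label).
No new definitions. F-71 / T1 / resolution in dim ≥ 4 or char p NOT proved here.
-/

noncomputable section

open CategoryTheory CategoryTheory.Limits AlgebraicGeometry TopologicalSpace IsLocalRing MvPolynomial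
open Literature.AlgebraicGeometry.Resolution Scheme.IdealSheafData

namespace Summit.ResolutionOfSingularities.ResolutionOfSingularities.Theorems

namespace CP2008Prop44

universe u

/-- σ = res-inputs-p-6's TREE THEOREM `IsBlowup.pointStep_trichotomy_of_stalkTau_eq_one` (p626364; statement = SIGNATURE e0ae65c3469c46ae) transported to a
point `q = x′` (chain bookkeeping via `stalkMapCongr`). [cite: CossartPiltant2008, Lemma 4.3 (5)] -/
theorem sigma_congr {X X' : Scheme.{u}} {π : X' ⟶ X} [IsLocallyNoetherian X] [IsLocallyNoetherian X']
    {Y : Closeds X} (hπ : IsBlowup π (vanishingIdeal Y)) {J : X.IdealSheafData} {μ : ℕ} (hμ : 1 ≤ μ)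
    {x' : X'} [IsRegularLocalRing (X.presheaf.stalk (π x'))]
    (hd : (maximalIdeal (X.presheaf.stalk (π x'))).spanFinrank = 3)
    {c : Fin 3 → X.presheaf.stalk (π x')} (hc : Ideal.span (Set.range c) = maximalIdeal _)
    (hcY : Ideal.span (Set.range c) = stalkIdeal (vanishingIdeal Y) (π x'))
    (hτ : stalkTau J (π x') μ = 1) (had : ∀ i, i ≠ 0 → IsAdapted c (stalkIdeal J (π x')) μ i)
    (hnear : IsNear π (vanishingIdeal Y) J μ x') (q : X') (h : q = x')
    [IsRegularLocalRing (X'.presheaf.stalk q)] (hdq : (maximalIdeal (X'.presheaf.stalk q)).spanFinrank = 3) :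
    -- (i)/(ii): rational in the `u₁`-chart — origin after the shear `u₂ ↦ u₂ − a u₁`
    (∃ (a : X.presheaf.stalk (π x')) (c' : Fin 3 → X'.presheaf.stalk q),
        c' 1 = (stalkMapCongr π x' q h) (c 1) ∧
        (stalkMapCongr π x' q h) (c 0) = (stalkMapCongr π x' q h) (c 1) * c' 0 ∧
        (stalkMapCongr π x' q h) (c 2 - a * c 1) = (stalkMapCongr π x' q h) (c 1) * c' 2 ∧
        Ideal.span {c' 0, c' 1, c' 2} = maximalIdeal (X'.presheaf.stalk q) ∧
        Function.Surjective (ResidueField.map (stalkMapCongr π x' q h)) ∧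
        stalkIdeal (controlledTransform π (vanishingIdeal Y) J μ) q =
          Submodule.colon ((stalkIdeal J (π x')).map (stalkMapCongr π x' q h))
            ({(stalkMapCongr π x' q h) (c 1) ^ μ} : Set (X'.presheaf.stalk q))) ∨
    -- (iii): non-rational in the `u₁`-chart
    (∃ (t : X'.presheaf.stalk q) (P : Polynomial (X.presheaf.stalk (π x')))
        (c' : Fin 3 → X'.presheaf.stalk q),
        c' 1 = (stalkMapCongr π x' q h) (c 1) ∧
        (stalkMapCongr π x' q h) (c 0) = (stalkMapCongr π x' q h) (c 1) * c' 0 ∧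
        (stalkMapCongr π x' q h) (c 2) = (stalkMapCongr π x' q h) (c 1) * t ∧
        P.Monic ∧ c' 2 = Polynomial.eval₂ (stalkMapCongr π x' q h) t P ∧
        2 ≤ (P.map (residue _)).natDegree ∧ Irreducible (P.map (residue _)) ∧
        (∀ G : Polynomial (X.presheaf.stalk (π x')),
          Polynomial.eval₂ (stalkMapCongr π x' q h) t G ∈ maximalIdeal (X'.presheaf.stalk q) ↔
            P.map (residue _) ∣ G.map (residue _)) ∧
        Ideal.span {c' 0, c' 1, c' 2} = maximalIdeal (X'.presheaf.stalk q) ∧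
        stalkIdeal (controlledTransform π (vanishingIdeal Y) J μ) q =
          Submodule.colon ((stalkIdeal J (π x')).map (stalkMapCongr π x' q h))
            ({(stalkMapCongr π x' q h) (c 1) ^ μ} : Set (X'.presheaf.stalk q))) ∨
    -- (i′): the origin of the `u₂`-chart
    (∃ c' : Fin 3 → X'.presheaf.stalk q,
        c' 2 = (stalkMapCongr π x' q h) (c 2) ∧
        (stalkMapCongr π x' q h) (c 0) = (stalkMapCongr π x' q h) (c 2) * c' 0 ∧
        (stalkMapCongr π x' q h) (c 1) = (stalkMapCongr π x' q h) (c 2) * c' 1 ∧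
        Ideal.span {c' 0, c' 1, c' 2} = maximalIdeal (X'.presheaf.stalk q) ∧
        Function.Surjective (ResidueField.map (stalkMapCongr π x' q h)) ∧
        stalkIdeal (controlledTransform π (vanishingIdeal Y) J μ) q =
          Submodule.colon ((stalkIdeal J (π x')).map (stalkMapCongr π x' q h))
            ({(stalkMapCongr π x' q h) (c 2) ^ μ} : Set (X'.presheaf.stalk q))) := by
  subst h
  simp only [stalkMapCongr_self]
  exact hπ.pointStep_trichotomy_of_stalkTau_eq_one hμ hd hdq hc hcY hτ had hnear

/-- Bridge (FORMER slot `stub_bridge`, now res-inputs-p-6's tree lemma `isAdapted_of_forall_initialForms_eq_C_mul_X_pow`, p627247): if every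
`μ`-initial form is `a · X₀^μ` then the system is ADAPTED at every index `i ≠ 0`. [cite: CossartJannsenSaito2020, (12.1)] [cite: CossartPiltant2008, §4 p. 11] -/
theorem bridge_isAdapted {R : Type u} [CommRing R] [IsLocalRing R] {c : Fin 3 → R} {J : Ideal R} {μ : ℕ}
    (h : ∀ G ∈ initialForms c J μ, ∃ a : ResidueField R, G = C a * X 0 ^ μ) :
    ∀ i, i ≠ 0 → IsAdapted c J μ i :=
  fun _ hi => isAdapted_of_forall_initialForms_eq_C_mul_X_pow c J μ 0 h hi

/-- If `𝔮 = 𝔭_ζ` for a generisation `ζ ⤳ x` and `J_x 𝒪_𝔮 ⊆ (𝔮𝒪_𝔮)^μ`, then `ord_ζ J ≥ μ` (Stacks 01J7). [cite: StacksProject, Tag 01J7] -/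
theorem le_idealOrder_of_map_le_pow {X : Scheme.{u}} (J : X.IdealSheafData) {x ζ : X} (hζx : ζ ⤳ x) (μ : ℕ)
    (hle : (stalkIdeal J x).map (algebraMap _ (Localization.AtPrime (primeOfSpecializes hζx))) ≤
      maximalIdeal (Localization.AtPrime (primeOfSpecializes hζx)) ^ μ) :
    (μ : ℕ∞) ≤ idealOrder J ζ := by
  rw [le_idealOrder_iff]
  letI := (X.presheaf.stalkSpecializes hζx).hom.toAlgebra
  haveI hloc := isLocalizationAtPrime_stalkSpecializes hζx
  let e : Localization.AtPrime ((maximalIdeal (X.presheaf.stalk ζ)).comap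
      (X.presheaf.stalkSpecializes hζx).hom) ≃ₐ[X.presheaf.stalk x] X.presheaf.stalk ζ :=
    IsLocalization.algEquiv
      ((maximalIdeal (X.presheaf.stalk ζ)).comap (X.presheaf.stalkSpecializes hζx).hom).primeCompl _ _
  have hmap : (stalkIdeal J x).map (algebraMap _ (X.presheaf.stalk ζ)) = stalkIdeal J ζ :=
    stalkIdeal_map_stalkSpecializes J hζx
  have h1 := (map_le_pow_maximalIdeal_iff_of_ringEquiv e.toRingEquiv
    ((stalkIdeal J x).map (algebraMap _ (Localization.AtPrime _))) μ).mpr hle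
  rw [Ideal.map_map] at h1
  have hcomp : (e.toRingEquiv.toRingHom).comp
      (algebraMap (X.presheaf.stalk x) (Localization.AtPrime _)) =
        algebraMap (X.presheaf.stalk x) (X.presheaf.stalk ζ) := by
    ext r
    exact e.commutes r
  rw [RingEquiv.toRingHom_eq_coe] at hcomp
  rwa [hcomp, hmap] at h1

/-- The stalk of the weak transform at `q = x′` is the colon by the `μ`-th power of the generator of the exceptional ideal. [cite: CossartPiltant2008, §4 (11)] -/
theorem stalkIdeal_controlledTransform_eq_colon_congr {X X' : Scheme.{u}} [IsLocallyNoetherian X] [IsLocallyNoetherian X'] {π : X' ⟶ X}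
    (Y : Closeds X) (J : X.IdealSheafData) (μ : ℕ) {x' : X'} (q : X') (h : q = x') (v : X.presheaf.stalk (π x'))
    (hv : (stalkIdeal (vanishingIdeal Y) (π x')).map (stalkMapCongr π x' q h) = Ideal.span {stalkMapCongr π x' q h v}) :
    stalkIdeal (controlledTransform π (vanishingIdeal Y) J μ) q =
      Submodule.colon ((stalkIdeal J (π x')).map (stalkMapCongr π x' q h)) ({stalkMapCongr π x' q h v ^ μ} : Set (X'.presheaf.stalk q)) := by
  subst h
  simp only [stalkMapCongr_self] at hv ⊢
  rw [controlledTransform, stalkIdeal_colon, stalkIdeal_pow, stalkIdeal_comap_eq_map_stalkMap, stalkIdeal_comap_eq_map_stalkMap, hv,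
    Ideal.span_singleton_pow]
  exact Submodule.colon_span

/-- κ″ transported to a point `q = x′`. [cite: CossartPiltant2008, Prop. 4.4 (proof, p. 11)] -/
theorem curveStep_succ_centre_congr {X X' : Scheme.{u}} {π : X' ⟶ X} [IsLocallyNoetherian X] [IsLocallyNoetherian X'] (hX : Scheme.IsRegular X)
    {Y : Closeds X} (hreg : Scheme.IsRegular (vanishingIdeal Y).subscheme) (hπ : IsBlowup π (vanishingIdeal Y))
    {J : X.IdealSheafData} {μ : ℕ} (hμ : 1 ≤ μ) (hY : ∀ y ∈ (Y : Set X), idealOrder J y = μ)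
    {x' : X'} [IsRegularLocalRing (X.presheaf.stalk (π x'))] (q : X') (h : q = x') [IsRegularLocalRing (X'.presheaf.stalk q)]
    (hd : (maximalIdeal (X.presheaf.stalk (π x'))).spanFinrank = 3) (hd' : (maximalIdeal (X'.presheaf.stalk q)).spanFinrank = 3)
    {ζ : X'} (hζx' : ζ ⤳ q) (hcohζ : Order.coheight ζ = 2) (hcohη : Order.coheight (π ζ) = 2)
    (hYη : (Y : Set X) = closure {π ζ}) (hζnear : IsNear π (vanishingIdeal Y) J μ ζ)
    {Y' : Closeds X'} (hY'ζ : (Y' : Set X') = closure {ζ})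
    {yv uv wv : X.presheaf.stalk (π x')} (hgen : Ideal.span {yv, uv, wv} = maximalIdeal _)
    (hyu : Ideal.span {yv, uv} = stalkIdeal (vanishingIdeal Y) (π x')) {y' : X'.presheaf.stalk q}
    (hrel : stalkMapCongr π x' q h yv = stalkMapCongr π x' q h uv * y')
    (hgen' : Ideal.span {y', stalkMapCongr π x' q h uv, stalkMapCongr π x' q h wv} = maximalIdeal _) :
    stalkMapCongr π x' q h uv ∈ stalkIdeal (vanishingIdeal Y') q ∧
      ∃ β ∈ maximalIdeal (X.presheaf.stalk (π x')),
        Ideal.span {y' + stalkMapCongr π x' q h β, stalkMapCongr π x' q h uv} = stalkIdeal (vanishingIdeal Y') q := by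
  subst h
  simp only [stalkMapCongr_self] at hrel hgen' ⊢
  exact curveStep_succ_centre hX hreg hπ hμ hY hd hd' hζx' hcohζ hcohη hYη hζnear hY'ζ hgen hyu hrel hgen'

/-- A non-rational chart point has a non-trivial residue field extension: `k(x) → k(x′)` is NOT onto. [cite: CossartPiltant2008, Lemma 4.3 (5)] -/
theorem not_surjective_residueField_map_of_two_le_natDegree {R R' : Type u} [CommRing R] [CommRing R'] [IsLocalRing R] [IsLocalRing R']
    (φ : R →+* R') [IsLocalHom φ] {t : R'} {P : Polynomial R} (h2 : 2 ≤ (P.map (residue R)).natDegree)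
    (hres : ∀ G : Polynomial R, Polynomial.eval₂ φ t G ∈ maximalIdeal R' ↔ P.map (residue R) ∣ G.map (residue R)) :
    ¬ Function.Surjective (ResidueField.map φ) := by
  intro hs
  obtain ⟨r', hr'⟩ := hs (residue R' t)
  obtain ⟨r, rfl⟩ := IsLocalRing.residue_surjective r'
  rw [ResidueField.map_residue] at hr'
  have hmem : Polynomial.eval₂ φ t (Polynomial.X - Polynomial.C r) ∈ maximalIdeal R' := by
    rw [Polynomial.eval₂_sub, Polynomial.eval₂_X, Polynomial.eval₂_C, ← residue_eq_zero_iff, map_sub, hr', sub_self]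
  have hdvd := (hres _).mp hmem
  rw [Polynomial.map_sub, Polynomial.map_X, Polynomial.map_C] at hdvd
  have hle := Polynomial.natDegree_le_of_dvd hdvd (Polynomial.X_sub_C_ne_zero _)
  rw [Polynomial.natDegree_X_sub_C] at hle
  omega

/-- A maximal ideal of embedding dimension `3` is not generated by two elements. [folklore] -/
theorem false_of_span_pair_eq_maximalIdeal {R : Type u} [CommRing R] [IsLocalRing R] {a b : R}
    (h : Ideal.span {a, b} = maximalIdeal R) (hd : (maximalIdeal R).spanFinrank = 3) : False := by
  have h1 : (Ideal.span {a, b}).spanFinrank ≤ ({a, b} : Set R).ncard :=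
    Submodule.spanFinrank_span_le_ncard_of_finite (Set.toFinite _)
  have h2 : ({a, b} : Set R).ncard ≤ 2 := by
    refine (Set.ncard_insert_le a {b}).trans ?_
    rw [Set.ncard_singleton]
  have h3 : (Ideal.span {a, b}).spanFinrank = 3 := by rw [h]; exact hd
  omega

/-- Line centre, chain form (FORMER slot `stub_lineCentre`; = the CONTRACT's `hPsucc_pt` on the scheme side): in the T1 chain, if step `n` is a POINT
step in the `u`-chart (`𝔪_n 𝒪_{n+1} = (φ u)`) and step `n + 1` a CURVE step, then for every ADAPTED label `(y, u, w)` of `𝒪_{x_n}` with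
`φ y = φ u · y′` and `(φ u, y′)` an rsop pair, the centre ideal at `x_{n+1}` is `(y′, φ u)` — from `stalkIdeal_vanishingIdeal_closure_eq_span_pair_of_adapted`
(p627545, packaging res-inputs-p-5a's p623553): the generic point `η′` of `Y_{n+1}` is a non-closed near point over `x_n` (`hcoinc`).
[cite: CossartPiltant2008, Lemma 4.3 (5), Prop. 4.4 (proof, p. 11)] -/
theorem lineCentre_chain (Xs : ℕ → Scheme.{u})
    (hN : ∀ n, IsLocallyNoetherian (Xs n)) (hXreg : ∀ n, Scheme.IsRegular (Xs n))
    (π : ∀ n, Xs (n + 1) ⟶ Xs n) (Y : ∀ n, Closeds (Xs n)) (y : ∀ n, Xs (n + 1))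
    (J : ∀ n, (Xs n).IdealSheafData) {μ : ℕ} (hμ : 1 ≤ μ)
    (hy : ∀ n, π (n + 1) (y (n + 1)) = y n)
    (hmem : ∀ n, π n (y n) ∈ (Y n : Set (Xs n)))
    (hcl : ∀ n, IsClosed ({π n (y n)} : Set (Xs n)))
    (hYirr : ∀ n, IsIrreducible ((Y n : Closeds (Xs n)) : Set (Xs n)))
    (hYreg : ∀ n, Scheme.IsRegular (vanishingIdeal (Y n)).subscheme)
    (hYord : ∀ n, ∀ z ∈ (Y n : Set (Xs n)), idealOrder (J n) z = μ)
    (hπ : ∀ n, IsBlowup (π n) (vanishingIdeal (Y n)))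
    (hJ : ∀ n, J (n + 1) = controlledTransform (π n) (vanishingIdeal (Y n)) (J n) μ)
    (hbd : ∀ n (z : Xs n), idealOrder (J n) z ≤ μ)
    (hcodim : ∀ n, ∀ z ∈ (J n).support, 1 < Order.coheight z)
    (hd : ∀ n, (maximalIdeal ((Xs n).presheaf.stalk (π n (y n)))).spanFinrank = 3)
    (hnear : ∀ n, IsNear (π n) (vanishingIdeal (Y n)) (J n) μ (y n))
    (hτ : ∀ n, @stalkTau (Xs n) (J n) (π n (y n)) (hXreg n (π n (y n))) μ = 1)
    (hG : ∀ n, IsGRing ((Xs n).presheaf.stalk (π n (y n))))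
    (hcoinc : ∀ n (z : Xs n), z ⤳ π n (y n) → idealOrder (J n) z = μ → z ∈ (Y n : Set (Xs n)))
    (n : ℕ) (hn : (Y n : Set (Xs n)) = {π n (y n)}) (hn1 : (Y (n + 1) : Set (Xs (n + 1))) ≠ {π (n + 1) (y (n + 1))})
    (yv uv wv : chainRing Xs π y n) (y' : chainRing Xs π y (n + 1))
    (hgen : Ideal.span {yv, uv, wv} = maximalIdeal _)
    (had : ∀ i, i ≠ 0 → IsAdapted ![yv, uv, wv] (chainIdeal Xs π y J n) μ i)
    (hchart : (maximalIdeal (chainRing Xs π y n)).map (chainMap Xs π y hy n) = Ideal.span {chainMap Xs π y hy n uv})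
    (hrel : chainMap Xs π y hy n yv = chainMap Xs π y hy n uv * y')
    (hrsop : IsRsopPart ![chainMap Xs π y hy n uv, y']) :
    Ideal.span {y', chainMap Xs π y hy n uv} = stalkIdeal (vanishingIdeal (Y (n + 1))) (π (n + 1) (y (n + 1))) := by
  classical
  haveI := hN
  have _hG := hG; have _hbd := hbd; have _hnear := hnear; have _hYreg := hYreg
  -- the point step `n`
  have hYn : Y n = ⟨{π n (y n)}, hcl n⟩ := Closeds.ext hn
  have hπ' : IsBlowup (π n) (vanishingIdeal ⟨{π n (y n)}, hcl n⟩) := hYn ▸ hπ n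
  have hordx : idealOrder (J n) (π n (y n)) = μ := hYord n _ (hmem n)
  -- the curve `Y (n+1)` and its generic point
  obtain ⟨hYη, hηne, hηx, -, -, -⟩ :=
    genericPoint_curve_facts (hXreg (n + 1)) hμ (hcodim (n + 1)) (hYirr (n + 1)) (hYord (n + 1)) (hmem (n + 1)) (hcl (n + 1))
      (hd (n + 1)) hn1
  set η' := (hYirr (n + 1)).genericPoint with hη'_def
  have hηY : η' ∈ (Y (n + 1) : Set (Xs (n + 1))) := by rw [hYη]; exact subset_closure rfl
  have hηcl : ¬ IsClosed ({η'} : Set (Xs (n + 1))) := by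
    intro hc
    apply hηne
    have h1 : π (n + 1) (y (n + 1)) ∈ closure ({η'} : Set (Xs (n + 1))) := hYη ▸ hmem (n + 1)
    rw [hc.closure_eq, Set.mem_singleton_iff] at h1
    exact h1.symm
  -- `π_n η′ = x_n` (coincidence locus at the point step)
  have hπη : π n η' = π n (y n) := by
    have hsp : π n η' ⤳ π n (y n) := by
      have h := hηx.map (π n).base.hom.continuous
      rwa [hy n] at h
    by_contra hne
    have hnot : π n η' ∉ ((vanishingIdeal (Y n)).support : Set (Xs n)) := by
      rw [Scheme.IdealSheafData.coe_support_vanishingIdeal, hn]; exact hne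
    have hord : idealOrder (J n) (π n η') = μ := by
      rw [← (hπ n).idealOrder_controlledTransform_of_not_mem (J n) μ hnot, ← hJ n]; exact hYord (n + 1) η' hηY
    exact hne (by simpa [hn] using hcoinc n (π n η') hsp hord)
  have hnear' : IsNear (π n) (vanishingIdeal ⟨{π n (y n)}, hcl n⟩) (J n) μ η' := by
    rw [← hYn, isNear_iff, ← hJ n]; exact hYord (n + 1) η' hηY
  -- the label
  have range3 : Set.range ![yv, uv, wv] = {yv, uv, wv} := by
    ext a
    simp only [Set.mem_range, Set.mem_insert_iff, Set.mem_singleton_iff]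
    constructor
    · rintro ⟨i, rfl⟩
      fin_cases i
      · exact Or.inl rfl
      · exact Or.inr (Or.inl rfl)
      · exact Or.inr (Or.inr rfl)
    · rintro (h | h | h)
      · exact ⟨0, by simp [h]⟩
      · exact ⟨1, by simp [h]⟩
      · exact ⟨2, by simp [h]⟩
  have hc : Ideal.span (Set.range ![yv, uv, wv]) = maximalIdeal _ := by rw [range3]; exact hgen
  have hYc : Y (n + 1) = ⟨closure {η'}, isClosed_closure⟩ := Closeds.ext hYη
  have hcM : chainMap Xs π y hy n = stalkMapCongr (π n) (y n) (π (n + 1) (y (n + 1))) (hy n) := rfl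
  rw [hcM] at hchart hrel hrsop
  have h := stalkIdeal_vanishingIdeal_closure_eq_span_pair_of_adapted_congr (hXreg n) (hcl n) hπ' hordx (hd n) (hτ n) hc had
    (π (n + 1) (y (n + 1))) (hy n) (by simpa using hchart) (by simpa using hrel) (by simpa using hrsop) hπη hnear' hηcl hηx
  rw [hYc, h, hcM]
  simp

end CP2008Prop44

end Summit.ResolutionOfSingularities.ResolutionOfSingularities.Theorems

end
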